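import Literature.NumberTheory.Sieve.MoebiusCoprimeTailSums

/-!
# Tail of `Σ μ(n) log² n / n` over `(n, q) = 1` (soloist file, project (F)-kernel, L1)

Soloist file (informed mode).  The Literature file `MoebiusCoprimeTailSums` bounds the tails
`Σ_{A < n ≤ W, (n,q)=1} μ(n)/n` and `Σ_{A < n ≤ W, (n,q)=1} μ(n) log n/n` by
`C 4^{ω(q)} (log A)^{-B}` (Siegel–Walfisz + Abel summation).  Here we add the weight `log² n / n`,
needed for the main term of the balanced twin window with the divisor weight
`μ(e₁) μ(e₂) log²(e₁ e₂) = μ log² ⊗ μ + 2 μ log ⊗ μ log + μ ⊗ μ log²`: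
`|Σ_{A < n ≤ W, (n,q)=1} μ(n) log² n / n| ≤ C 4^{ω(q)} (2 + log W) (log A)^{-B}`
(Abel lemma `MoebiusCoprimeTail.abs_sum_Ioc_mul_le_of_abel` with `g(t) = log² t / t`,
`K = 2 + log W`: `|g| ≤ log W · log t / t`, `|g'| = log t |2 - log t| / t² ≤ (2 + log W) log t / t²`).
[folklore]
-/

namespace Summit.Parity.BatemanHorn.Theorems.PairWindow

open Finset Real
open scoped ArithmeticFunction.Moebius ArithmeticFunction.omega

/-- **Tail of `Σ μ(n) log² n / n` over `(n, q) = 1`**: for `B ≥ 0` there is `C ≥ 0` with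
`|Σ_{A < n ≤ W, (n,q)=1} μ(n) log² n / n| ≤ C 4^{ω(q)} (2 + log W) (log A)^{−B}` for all `q ≥ 1`,
`2 ≤ A ≤ W`. [folklore] -/
theorem abs_sum_Ioc_coprime_moebius_mul_log_sq_div_le {B : ℝ} (hB : 0 ≤ B) :
    ∃ C : ℝ, 0 ≤ C ∧ ∀ q : ℕ, q ≠ 0 → ∀ A W : ℝ, 2 ≤ A → A ≤ W →
      |∑ n ∈ (Ioc ⌊A⌋₊ ⌊W⌋₊).filter (fun n : ℕ => n.Coprime q),
          (μ n : ℝ) * Real.log n ^ 2 / n| ≤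
        C * (4 : ℝ) ^ q.primeFactors.card * (2 + Real.log W) / Real.log A ^ B := by
  obtain ⟨C₀, hC₀, hM⟩ :=
    Literature.NumberTheory.Sieve.MoebiusCoprimeTail.abs_sum_coprime_moebius_le_logPow
      (B := B + 3) (by linarith)
  refine ⟨10 * C₀, by positivity, fun q hq A W hA hAW => ?_⟩
  set C₄ : ℝ := C₀ * (4 : ℝ) ^ q.primeFactors.card with hC₄
  have hC₄0 : 0 ≤ C₄ := by positivity
  have hM' : ∀ t : ℝ, 2 ≤ t →
      |∑ n ∈ (Icc 1 ⌊t⌋₊).filter (fun n : ℕ => n.Coprime q), (μ n : ℝ)| ≤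
        C₄ * t / Real.log t ^ (B + 3) := fun t ht => hM q hq t ht
  have hW2 : (2 : ℝ) ≤ W := hA.trans hAW
  have hlogW : 0 ≤ Real.log W := Real.log_nonneg (by linarith)
  have hK : (0 : ℝ) ≤ 2 + Real.log W := by linarith
  -- `g(t) = log² t / t`, `K = 2 + log W`
  set g : ℝ → ℝ := fun t => Real.log t * Real.log t / t with hgdef
  have hgd : ∀ t : ℝ, 0 < t →
      HasDerivAt g (Real.log t * (2 - Real.log t) / t ^ 2) t := by
    intro t ht
    have ht' : t ≠ 0 := ht.ne'
    have h1 := ((Real.hasDerivAt_log ht').mul (Real.hasDerivAt_log ht')).div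
      (hasDerivAt_id t) ht'
    have hfg : (Real.log * Real.log / id : ℝ → ℝ) = g := by
      funext x; simp only [hgdef, Pi.mul_apply, Pi.div_apply, id]
    rw [hfg] at h1
    refine h1.congr_deriv ?_
    simp only [Pi.mul_apply, id]
    field_simp
    ring
  have hg_diff : ∀ t ∈ Set.Icc A W, DifferentiableAt ℝ g t := fun t ht =>
    (hgd t (by linarith [ht.1])).differentiableAt
  have hderiv : ∀ t ∈ Set.Icc A W, deriv g t = Real.log t * (2 - Real.log t) / t ^ 2 :=
    fun t ht => (hgd t (by linarith [ht.1])).deriv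
  have hg_cont : ContinuousOn (deriv g) (Set.Icc A W) := by
    have hlc : ContinuousOn Real.log (Set.Icc A W) := Real.continuousOn_log.mono
      (fun t ht => Set.mem_compl_singleton_iff.2
        (ne_of_gt (show (0 : ℝ) < t by linarith [ht.1])))
    have hc : ContinuousOn (fun t : ℝ => Real.log t * (2 - Real.log t) / t ^ 2)
        (Set.Icc A W) := by
      refine ContinuousOn.div (hlc.mul (continuousOn_const.sub hlc)) (continuousOn_pow 2) ?_
      intro t ht; exact pow_ne_zero 2 (by linarith [ht.1] : t ≠ 0)
    exact hc.congr hderiv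
  have hg : ∀ t ∈ Set.Icc A W, |g t| ≤ (2 + Real.log W) * Real.log t / t := by
    intro t ht
    have ht0 : 0 < t := by linarith [ht.1]
    have hlt : Real.log 2 ≤ Real.log t := Real.log_le_log two_pos (hA.trans ht.1)
    have hl2 : 0 < Real.log 2 := Real.log_pos (by norm_num)
    have hlt0 : 0 ≤ Real.log t := by linarith
    have hltW : Real.log t ≤ Real.log W := Real.log_le_log ht0 ht.2
    simp only [hgdef]
    rw [abs_of_nonneg (div_nonneg (mul_nonneg hlt0 hlt0) ht0.le)]
    refine div_le_div_of_nonneg_right ?_ ht0.le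
    exact mul_le_mul_of_nonneg_right (by linarith) hlt0
  have hg' : ∀ t ∈ Set.Icc A W, |deriv g t| ≤ (2 + Real.log W) * Real.log t / t ^ 2 := by
    intro t ht
    have ht0 : 0 < t := by linarith [ht.1]
    have hlt : Real.log 2 ≤ Real.log t := Real.log_le_log two_pos (hA.trans ht.1)
    have hl2 : 0 < Real.log 2 := Real.log_pos (by norm_num)
    have hlt0 : 0 ≤ Real.log t := by linarith
    have hltW : Real.log t ≤ Real.log W := Real.log_le_log ht0 ht.2
    rw [hderiv t ht, abs_div, abs_of_pos (pow_pos ht0 2), abs_mul, abs_of_nonneg hlt0]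
    refine div_le_div_of_nonneg_right ?_ (pow_pos ht0 2).le
    have h2 : |2 - Real.log t| ≤ 2 + Real.log W := by
      rw [abs_le]; constructor <;> linarith
    calc Real.log t * |2 - Real.log t| ≤ Real.log t * (2 + Real.log W) :=
          mul_le_mul_of_nonneg_left h2 hlt0
      _ = (2 + Real.log W) * Real.log t := by ring
  have h := Literature.NumberTheory.Sieve.MoebiusCoprimeTail.abs_sum_Ioc_mul_le_of_abel
    hC₄0 hB hM' hK hA hAW hg_diff hg_cont hg hg'
  have hsum : ∑ n ∈ (Ioc ⌊A⌋₊ ⌊W⌋₊).filter (fun n : ℕ => n.Coprime q),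
      (μ n : ℝ) * Real.log n ^ 2 / n =
      ∑ n ∈ (Ioc ⌊A⌋₊ ⌊W⌋₊).filter (fun n : ℕ => n.Coprime q), (μ n : ℝ) * g n :=
    Finset.sum_congr rfl fun n _ => by simp only [hgdef]; ring
  rw [hsum]
  refine h.trans (le_of_eq ?_)
  rw [hC₄]; ring

end Summit.Parity.BatemanHorn.Theorems.PairWindow
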